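import Summits.ValiantsHypothesis.ValiantsHypothesis.Theorems.KPlusLogSqLawTropicalBNewtonPolygon

/-!
# Route «KPlusLogSqLaw», crux `TropicalB` (stmt-ValiantsHypothesis-19771) — the BOX form of Jarník's law:
# `n³ ≤ 144·m²·(exponent spread)·(valuation spread) + 8·m·(exponent spread)` (uniform in `K`)

HONEST FRAMING.  Helper lemmas toward the registered stub `stub_tropThin` of `Cruxes/TropicalB/Lines/birth.lean` (crux
`Summit.ValiantsHypothesis.ValiantsHypothesis.Theses.KPlusLogSqLaw.TropicalB`, item `stmt-ValiantsHypothesis-19771`, route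
`KPlusLogSqLaw`, DRAFT; cell `pub-symmetroid`, seat val-sym-trop-p1 g2).  Sharpening of this seat's `NewtonPolygon.chain_cube_le`
(perimeter form `n³ ≤ 24·(m·ΔD + 2m·ΔV)²`, file `…TropicalBNewtonPolygon`) to the PRODUCT form: the two budgets of the convex lattice
polygon — horizontal `Σ ΔS ≤ W` and vertical `Σ |ΔC| ≤ H` — are spent separately (at most `s(2t+1)` distinct edge vectors fit in the
box `[1,s] × [−t,t]`, at most `W/(s+1)` edges are wider than `s`, at most `H/(t+1)` taller than `t`; take `s ≈ 4W/n`, `t ≈ 4H/n`):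

* `NewtonPolygon.le_box_count` (abstract): `n ≤ s(2t+1) + #{ΔS > s} + #{|ΔC| > t}` and the two Markov bounds;
* `NewtonPolygon.cube_le_box` (abstract): `n³ ≤ 64·W·H + 8·W·n` for a sandwiched lattice chain with `Σ ΔS ≤ W`, `Σ|ΔC| ≤ H`;
* `NewtonPolygon.chain_cube_le_box` (designs): exponents in `[D₀, D₁]`, valuations in `[V₀, V₁]` ⇒
  `n³ ≤ 144·m²·(D₁ − D₀)·(V₁ − V₀) + 8·m·(D₁ − D₀)`.

READING (located necessary condition on hypothetical counterexamples; nothing about `TropicalB` itself): exponent spread TIMES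
valuation spread of a design carrying a dominant chain of length `n` is at least `(n³ − 8m·ΔD)/(144 m²)` — an «uncertainty» form of
the size laws: a thin-window monster needs `ΔD·ΔV > 2^{3C·log₂² m}/(144 m²)` eventually for every `C`, and neither factor can
compensate beyond the linear laws `n ≤ m·ΔD` (`chain_le_mul_spread`) and `n ≤ 2m·ΔV + 1` (`chain_le_valSpread`).  The product form
beats the perimeter form whenever the two spreads are unbalanced (e.g. `ΔD = m`, `ΔV = m²`: `n = O(m^{5/3})` against `O(m²)`).
[folklore: V. Jarník 1926; the box count is the standard proof of the `O((WH)^{1/3})` vertex bound for convex lattice polygons in a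
`W × H` box.]  Nothing here bears on `TropicalB` / `KPlusLogSqLaw` in the window, on `Lifting`, DoorA26 / DoorA34, `MatrixDescartes`
(`stmt-ValiantsHypothesis-18050`) or VP ≠ VNP.
-/

-- `Summit.ValiantsHypothesis.ValiantsHypothesis.…` repeats a component by the D-0017 layout
-- (single-conjunct summit), which the `dupNamespace` linter flags; the name is mandated.
set_option linter.dupNamespace false
set_option autoImplicit false

namespace Summit.ValiantsHypothesis.ValiantsHypothesis.Theorems.KPlusLogSqLaw

open Summit.ValiantsHypothesis.ValiantsHypothesis.Theorems.MatrixDescartes.Negative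
open scoped BigOperators
open Finset

namespace NewtonPolygon

/-! ## 1. Abstract: the box count -/

section Lattice

variable {n : ℕ} {Θ S C : ℕ → ℤ}

/-- **Box count.**  For every `s, t`: `n ≤ s(2t+1) + #{i : ΔSᵢ > s} + #{i : |ΔCᵢ| > t}` (the edges inside the box `[1,s]×[−t,t]`
are pairwise distinct lattice vectors), and the Markov bounds `(s+1)·#{ΔS > s} ≤ Σ ΔS`, `(t+1)·#{|ΔC| > t} ≤ Σ |ΔC|`. [folklore] -/
theorem le_box_count (hΘ : ∀ i, i < n → Θ i < Θ (i + 1))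
    (hsw : ∀ i, i < n → Θ i * (S (i + 1) - S i) < C (i + 1) - C i ∧
      C (i + 1) - C i < Θ (i + 1) * (S (i + 1) - S i)) (s t : ℕ) :
    (n : ℤ) ≤ s * (2 * t + 1) +
        ((Finset.range n).filter fun i => (s : ℤ) < S (i + 1) - S i).card +
        ((Finset.range n).filter fun i => (t : ℤ) < |C (i + 1) - C i|).card ∧
      ((s : ℤ) + 1) * (((Finset.range n).filter fun i => (s : ℤ) < S (i + 1) - S i).card : ℤ) ≤
        ∑ i ∈ Finset.range n, (S (i + 1) - S i) ∧
      ((t : ℤ) + 1) * (((Finset.range n).filter fun i => (t : ℤ) < |C (i + 1) - C i|).card : ℤ) ≤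
        ∑ i ∈ Finset.range n, |C (i + 1) - C i| := by
  classical
  refine ⟨?_, ?_, ?_⟩
  · -- split `range n` into the box part and the rest
    have hbox : ((Finset.range n).filter fun i => S (i + 1) - S i ≤ s ∧ |C (i + 1) - C i| ≤ t).card ≤ s * (2 * t + 1) := by
      have hcard : ((Finset.Icc (1 : ℤ) s) ×ˢ (Finset.Icc (-(t : ℤ)) t)).card = s * (2 * t + 1) := by
        rw [Finset.card_product, Int.card_Icc, Int.card_Icc]
        have e1 : ((s : ℤ) + 1 - 1).toNat = s := by simp
        have e2 : ((t : ℤ) + 1 - -(t : ℤ)).toNat = 2 * t + 1 := by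
          rw [show (t : ℤ) + 1 - -(t : ℤ) = ((2 * t + 1 : ℕ) : ℤ) by push_cast; ring, Int.toNat_natCast]
        rw [e1, e2]
      rw [← hcard]
      refine Finset.card_le_card_of_injOn (fun i => (S (i + 1) - S i, C (i + 1) - C i)) ?_ ?_
      · intro i hi
        simp only [Finset.coe_filter, Finset.mem_range, Set.mem_setOf_eq] at hi
        obtain ⟨hin, h1, h2⟩ := hi
        have hs := step_pos hΘ hsw hin
        have h3 := neg_abs_le (C (i + 1) - C i)
        have h4 := le_abs_self (C (i + 1) - C i)
        simp only [Finset.coe_product, Finset.coe_Icc, Set.mem_prod, Set.mem_Icc]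
        refine ⟨⟨by linarith, h1⟩, by linarith, by linarith⟩
      · intro i hi j hj h
        simp only [Finset.coe_filter, Finset.mem_range, Set.mem_setOf_eq] at hi hj
        exact edge_injOn hΘ hsw (Set.mem_Iio.2 hi.1) (Set.mem_Iio.2 hj.1) h
    have hsplit := Finset.card_filter_add_card_filter_not (s := Finset.range n)
      (fun i => S (i + 1) - S i ≤ s ∧ |C (i + 1) - C i| ≤ t)
    rw [Finset.card_range] at hsplit
    have hrest : ((Finset.range n).filter fun i => ¬ (S (i + 1) - S i ≤ s ∧ |C (i + 1) - C i| ≤ t)).card ≤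
        ((Finset.range n).filter fun i => (s : ℤ) < S (i + 1) - S i).card +
        ((Finset.range n).filter fun i => (t : ℤ) < |C (i + 1) - C i|).card := by
      have hsub : ((Finset.range n).filter fun i => ¬ (S (i + 1) - S i ≤ s ∧ |C (i + 1) - C i| ≤ t)) ⊆
          ((Finset.range n).filter fun i => (s : ℤ) < S (i + 1) - S i) ∪
          ((Finset.range n).filter fun i => (t : ℤ) < |C (i + 1) - C i|) := by
        intro i hi
        rw [Finset.mem_filter] at hi
        rw [Finset.mem_union, Finset.mem_filter, Finset.mem_filter]
        by_contra h
        push Not at h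
        exact hi.2 ⟨h.1 hi.1, h.2 hi.1⟩
      exact (Finset.card_le_card hsub).trans (Finset.card_union_le _ _)
    have : (n : ℤ) = (((Finset.range n).filter fun i => S (i + 1) - S i ≤ s ∧ |C (i + 1) - C i| ≤ t).card : ℤ) +
        (((Finset.range n).filter fun i => ¬ (S (i + 1) - S i ≤ s ∧ |C (i + 1) - C i| ≤ t)).card : ℤ) := by
      exact_mod_cast hsplit.symm
    rw [this]
    have hbox' : ((((Finset.range n).filter fun i => S (i + 1) - S i ≤ s ∧ |C (i + 1) - C i| ≤ t).card : ℕ) : ℤ) ≤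
        (s : ℤ) * (2 * t + 1) := by exact_mod_cast hbox
    have hrest' := (Int.ofNat_le.2 hrest)
    push_cast at hrest'
    linarith
  · have h := Finset.card_nsmul_le_sum ((Finset.range n).filter fun i => (s : ℤ) < S (i + 1) - S i)
      (fun i => S (i + 1) - S i) ((s : ℤ) + 1) (fun i hi => by have := (Finset.mem_filter.1 hi).2; linarith)
    rw [nsmul_eq_mul, mul_comm] at h
    refine h.trans (Finset.sum_le_sum_of_subset_of_nonneg (Finset.filter_subset _ _) fun i hi _ => ?_)
    rw [Finset.mem_range] at hi
    exact (sub_pos.2 (step_pos hΘ hsw hi)).le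
  · have h := Finset.card_nsmul_le_sum ((Finset.range n).filter fun i => (t : ℤ) < |C (i + 1) - C i|)
      (fun i => |C (i + 1) - C i|) ((t : ℤ) + 1) (fun i hi => by have := (Finset.mem_filter.1 hi).2; linarith)
    rw [nsmul_eq_mul, mul_comm] at h
    exact h.trans (Finset.sum_le_sum_of_subset_of_nonneg (Finset.filter_subset _ _) fun i _ _ => abs_nonneg _)

/-- **Box form of Jarník's law** for a sandwiched lattice chain: if `Σ ΔS ≤ W` and `Σ |ΔC| ≤ H` then `n³ ≤ 64·W·H + 8·W·n`.
[folklore: Jarník 1926] -/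
theorem cube_le_box (hΘ : ∀ i, i < n → Θ i < Θ (i + 1))
    (hsw : ∀ i, i < n → Θ i * (S (i + 1) - S i) < C (i + 1) - C i ∧
      C (i + 1) - C i < Θ (i + 1) * (S (i + 1) - S i))
    {W H : ℤ} (hW : ∑ i ∈ Finset.range n, (S (i + 1) - S i) ≤ W) (hH : ∑ i ∈ Finset.range n, |C (i + 1) - C i| ≤ H) :
    (n : ℤ) ^ 3 ≤ 64 * W * H + 8 * W * n := by
  classical
  -- budgets are nonnegative
  have hW0 : 0 ≤ W := le_trans (Finset.sum_nonneg fun i hi => by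
    rw [Finset.mem_range] at hi; exact (sub_pos.2 (step_pos hΘ hsw hi)).le) hW
  have hH0 : 0 ≤ H := le_trans (Finset.sum_nonneg fun i _ => abs_nonneg _) hH
  rcases Nat.eq_zero_or_pos n with hn0 | hnpos
  · subst hn0
    have := mul_nonneg hW0 hH0
    push_cast
    nlinarith
  have hn : (0 : ℤ) < n := by exact_mod_cast hnpos
  -- thresholds `s = ⌊4W/n⌋`, `t = ⌊4H/n⌋`
  obtain ⟨s, hsZ⟩ : ∃ s : ℕ, (s : ℤ) = 4 * W / n :=
    ⟨(4 * W / n).toNat, Int.toNat_of_nonneg (Int.ediv_nonneg (by linarith) hn.le)⟩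
  obtain ⟨t, htZ⟩ : ∃ t : ℕ, (t : ℤ) = 4 * H / n :=
    ⟨(4 * H / n).toNat, Int.toNat_of_nonneg (Int.ediv_nonneg (by linarith) hn.le)⟩
  have hs1 : (s : ℤ) * n ≤ 4 * W := by rw [hsZ]; exact Int.ediv_mul_le _ hn.ne'
  have hs2 : 4 * W < ((s : ℤ) + 1) * n := by rw [hsZ]; exact Int.lt_ediv_add_one_mul_self _ hn
  have ht1 : (t : ℤ) * n ≤ 4 * H := by rw [htZ]; exact Int.ediv_mul_le _ hn.ne'
  have ht2 : 4 * H < ((t : ℤ) + 1) * n := by rw [htZ]; exact Int.lt_ediv_add_one_mul_self _ hn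
  obtain ⟨hcount, hMs, hMt⟩ := le_box_count hΘ hsw s t
  -- the two tail counts
  generalize ha : ((((Finset.range n).filter fun i => (s : ℤ) < S (i + 1) - S i).card : ℕ) : ℤ) = a at hcount hMs
  generalize hb : ((((Finset.range n).filter fun i => (t : ℤ) < |C (i + 1) - C i|).card : ℕ) : ℤ) = b at hcount hMt
  have hMs' : ((s : ℤ) + 1) * a ≤ W := hMs.trans hW
  have hMt' : ((t : ℤ) + 1) * b ≤ H := hMt.trans hH
  have h4a : 4 * a < n := by
    have key : ((s : ℤ) + 1) * (4 * a) < ((s : ℤ) + 1) * n := by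
      calc ((s : ℤ) + 1) * (4 * a) = 4 * (((s : ℤ) + 1) * a) := by ring
        _ ≤ 4 * W := by linarith
        _ < ((s : ℤ) + 1) * n := hs2
    exact lt_of_mul_lt_mul_left key (by positivity)
  have h4b : 4 * b < n := by
    have key : ((t : ℤ) + 1) * (4 * b) < ((t : ℤ) + 1) * n := by
      calc ((t : ℤ) + 1) * (4 * b) = 4 * (((t : ℤ) + 1) * b) := by ring
        _ ≤ 4 * H := by linarith
        _ < ((t : ℤ) + 1) * n := ht2
    exact lt_of_mul_lt_mul_left key (by positivity)
  -- hence `n ≤ 2 s (2t+1)`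
  have hn2 : (n : ℤ) ≤ 2 * ((s : ℤ) * (2 * t + 1)) := by linarith
  -- `n³ ≤ n² · 2 s (2t+1) = 2 (s n) (2 (t n) + n) ≤ 2 · 4W · (8H + n)`
  have htn0 : (0 : ℤ) ≤ 2 * ((t : ℤ) * n) + n := by positivity
  calc (n : ℤ) ^ 3 = (n : ℤ) ^ 2 * n := by ring
    _ ≤ (n : ℤ) ^ 2 * (2 * ((s : ℤ) * (2 * t + 1))) := mul_le_mul_of_nonneg_left hn2 (sq_nonneg _)
    _ = 2 * ((s : ℤ) * n) * (2 * ((t : ℤ) * n) + n) := by ring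
    _ ≤ 2 * (4 * W) * (2 * ((t : ℤ) * n) + n) :=
        mul_le_mul_of_nonneg_right (mul_le_mul_of_nonneg_left hs1 (by norm_num)) htn0
    _ ≤ 2 * (4 * W) * (2 * (4 * H) + n) := mul_le_mul_of_nonneg_left (by linarith) (by linarith)
    _ = 64 * W * H + 8 * W * n := by ring

end Lattice

/-! ## 2. Dominant chains of a design -/

section Design

variable {m K : ℕ} (d : Fin K → ℕ) (v ε : Fin m → Fin m → Fin K → ℤ)

/-- **Box form of Jarník's law for dominant chains** (`K`-free).  Along a chain of pairwise-consecutive-distinct dominant terms of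
a design with exponents in `[D₀, D₁]` and valuations in `[V₀, V₁]`,
`n³ ≤ 144·m²·(D₁ − D₀)·(V₁ − V₀) + 8·m·(D₁ − D₀)`: exponent spread times valuation spread is at least `(n³ − 8m·ΔD)/(144 m²)`.
[folklore: V. Jarník, Math. Z. 24 (1926)] -/
theorem chain_cube_le_box (D₀ D₁ : ℕ) (hd : ∀ l, D₀ ≤ d l ∧ d l ≤ D₁) (V₀ V₁ : ℤ)
    (hv : ∀ i j l, V₀ ≤ v i j l ∧ v i j l ≤ V₁) {n : ℕ}
    (θ : Fin (n + 1) → ℤ) (p : Fin (n + 1) → Equiv.Perm (Fin m) × (Fin m → Fin K)) (hθ : StrictMono θ)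
    (hdom : ∀ k, IsDominant d v ε (θ k) (p k)) (hne : ∀ k : Fin n, p k.castSucc ≠ p k.succ) :
    (n : ℤ) ^ 3 ≤ 144 * (m : ℤ) ^ 2 * ((D₁ : ℤ) - D₀) * (V₁ - V₀) + 8 * m * ((D₁ : ℤ) - D₀) := by
  obtain ⟨Θ, P, hΘ, hdomN, hneN⟩ := exists_natChain d v ε n θ p hθ hdom hne
  have hsw : ∀ i, i < n → Θ i * ((fun i => IntervalOpt.sl d univ (P i)) (i + 1) -
      (fun i => IntervalOpt.sl d univ (P i)) i) <
      (fun i => IntervalOpt.cst v univ (P i)) (i + 1) - (fun i => IntervalOpt.cst v univ (P i)) i ∧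
      (fun i => IntervalOpt.cst v univ (P i)) (i + 1) - (fun i => IntervalOpt.cst v univ (P i)) i <
      Θ (i + 1) * ((fun i => IntervalOpt.sl d univ (P i)) (i + 1) - (fun i => IntervalOpt.sl d univ (P i)) i) :=
    fun i hi => sandwich d v ε hdomN hneN hi
  -- horizontal budget: telescoping of the slopes inside `[m D₀, m D₁]`
  have hW : ∑ i ∈ Finset.range n, ((fun i => IntervalOpt.sl d univ (P i)) (i + 1) -
      (fun i => IntervalOpt.sl d univ (P i)) i) ≤ (m : ℤ) * ((D₁ : ℤ) - D₀) := by
    rw [Finset.sum_range_sub (fun i => IntervalOpt.sl d univ (P i))]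
    have h0 := sl_mem_of_bounds d D₀ D₁ hd (P 0)
    have hn := sl_mem_of_bounds d D₀ D₁ hd (P n)
    show IntervalOpt.sl d univ (P n) - IntervalOpt.sl d univ (P 0) ≤ _
    linarith [h0.1, hn.2]
  -- vertical budget and the valuation-spread law
  have hval := val_budget (S := fun i => IntervalOpt.sl d univ (P i)) (C := fun i => IntervalOpt.cst v univ (P i))
    hΘ hsw (B₀ := (m : ℤ) * V₀) (B₁ := (m : ℤ) * V₁) (fun i _ => cst_mem_of_bounds v V₀ V₁ hv (P i))
  have hH : ∑ i ∈ Finset.range n, |(fun i => IntervalOpt.cst v univ (P i)) (i + 1) -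
      (fun i => IntervalOpt.cst v univ (P i)) i| ≤ 2 * ((m : ℤ) * (V₁ - V₀)) := by
    have h2 := hval.2
    show ∑ i ∈ Finset.range n, |IntervalOpt.cst v univ (P (i + 1)) - IntervalOpt.cst v univ (P i)| ≤ _
    have e : ∑ i ∈ Finset.range n, |IntervalOpt.cst v univ (P (i + 1)) - IntervalOpt.cst v univ (P i)| =
        ∑ i ∈ Finset.range n, |(fun i => IntervalOpt.cst v univ (P i)) (i + 1) -
          (fun i => IntervalOpt.cst v univ (P i)) i| := rfl
    rw [e]
    linarith
  have hcube := cube_le_box (S := fun i => IntervalOpt.sl d univ (P i)) (C := fun i => IntervalOpt.cst v univ (P i))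
    (W := (m : ℤ) * ((D₁ : ℤ) - D₀)) (H := 2 * ((m : ℤ) * (V₁ - V₀))) hΘ hsw hW hH
  -- absorb the `8·W·n` term with `n ≤ 2m(V₁ − V₀) + 1`
  have hn1 : (n : ℤ) ≤ 2 * ((m : ℤ) * (V₁ - V₀)) + 1 := by have := hval.1; linarith
  have hΔD : (0 : ℤ) ≤ (m : ℤ) * ((D₁ : ℤ) - D₀) := by
    have h0 := sl_mem_of_bounds d D₀ D₁ hd (P 0)
    linarith [h0.1, h0.2]
  have h8 : 8 * ((m : ℤ) * ((D₁ : ℤ) - D₀)) * n ≤ 8 * ((m : ℤ) * ((D₁ : ℤ) - D₀)) * (2 * ((m : ℤ) * (V₁ - V₀)) + 1) :=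
    mul_le_mul_of_nonneg_left hn1 (by linarith)
  calc (n : ℤ) ^ 3 ≤ 64 * ((m : ℤ) * ((D₁ : ℤ) - D₀)) * (2 * ((m : ℤ) * (V₁ - V₀))) +
        8 * ((m : ℤ) * ((D₁ : ℤ) - D₀)) * n := hcube
    _ ≤ 64 * ((m : ℤ) * ((D₁ : ℤ) - D₀)) * (2 * ((m : ℤ) * (V₁ - V₀))) +
        8 * ((m : ℤ) * ((D₁ : ℤ) - D₀)) * (2 * ((m : ℤ) * (V₁ - V₀)) + 1) := by linarith [h8]
    _ = 144 * (m : ℤ) ^ 2 * ((D₁ : ℤ) - D₀) * (V₁ - V₀) + 8 * m * ((D₁ : ℤ) - D₀) := by ring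

end Design

end NewtonPolygon

end Summit.ValiantsHypothesis.ValiantsHypothesis.Theorems.KPlusLogSqLaw
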